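import Summits.AtomisticToContinuum.FouriersLaw.Theorems.OddSectorIrreversibilityOddDensityIsCorrectorCutoff
import Summits.AtomisticToContinuum.FouriersLaw.Theorems.OddSectorIrreversibilityResponseDensityGibbsCutoff
import Summits.AtomisticToContinuum.FouriersLaw.Theorems.BondHeatUncertaintySubdiffusiveBondHeatSiteEnergyDynkinTruncation
import Mathlib.MeasureTheory.Function.L2Space
import HarnessLib

/-!
# Clausius budget, part 1a: the energy estimate (uniqueness half of essential m-dissipativity)

Support file for crux `stmt-AtomisticToContinuum-9121` (`BondHeatUncertainty.ExtensiveSnapshotIrreversibility`),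
line `clausius-budget-sound-window`, stub `stub_clausiusBudget`. For the pinned anharmonic chain
`pinnedChain ω₂ lam β γ` (`ω₂ > 0`, `lam ≥ 0`, `β, γ > 0`, `N ≥ 1`), both baths at `T > 0`, generator
`L = L_{T,T}`, Gibbs state `μ_T`, `λ > 0`: `integral_sq_eq_zero_of_weak_resolvent` — a SMOOTH `h ∈ L²(μ_T)`
with `∫ (λF - LF) h dμ_T = 0` for all `F ∈ C_c^∞` vanishes, GIVEN the Dirichlet-form identity
`∫ φ Lφ dμ_T = -γT Σ_b ‖∂_{p_b} φ‖²` on `C_c^∞` (hypothesis (a) of the registered stub). Test with `F = χ_R² h`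
(`χ_R = χ(H/R)`, `…OddDensityIsCorrectorCutoff`), expand `L(χ_R · χ_R h)` (`generator_mul_smoothCutoff_hamiltonian`)
and absorb the carré-du-champ cross term by AM–GM: `λ‖χ_R h‖² ≤ C ∫_{H ≥ R} h² → 0`. With part 1b
(`…ClausiusBudgetRangeDense.lean`, Hörmander) this is the m-dissipativity of the closure of `(L, C_c^∞)` in
`L²(μ_T)` (Helffer–Nier 2005, Prop. 5.5; Eckmann–Pillet–Rey-Bellet 1999). No definitions; closes no item.
-/

noncomputable section

namespace Summit.AtomisticToContinuum.FouriersLaw.Theorems.ExtensiveSnapshotIrreversibility.ClausiusBudget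

open MeasureTheory Filter Topology Set
open scoped ENNReal NNReal ContDiff
open Literature.MathematicalPhysics.KineticTheory.HeatConduction
open Literature.MathematicalPhysics.KineticTheory
open Summit.AtomisticToContinuum.FouriersLaw.Theorems.SubdiffusiveBondHeat
open Summit.AtomisticToContinuum.FouriersLaw.Theorems.OddSectorIrreversibility

variable {N : ℕ}

/-! ### The contact weights -/

/-- The contact weights `[i = 0] + [i = N-1]` pick out the two bath sites:
`Σ_i ([i=0] + [i=N-1]) f i = f ⟨0⟩ + f ⟨N-1⟩` (`N ≥ 1`; for `N = 1` both are the same site). [folklore] -/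
theorem sum_contactWeight_mul (hN : 0 < N) (f : Fin N → ℝ) :
    ∑ i : Fin N, ((if i.val = 0 then (1 : ℝ) else 0) + (if i.val = N - 1 then (1 : ℝ) else 0)) * f i =
      f ⟨0, hN⟩ + f ⟨N - 1, Nat.sub_lt hN one_pos⟩ := by
  have h1 : ∀ i : Fin N, ((if i.val = 0 then (1 : ℝ) else 0) + (if i.val = N - 1 then (1 : ℝ) else 0)) * f i
      = (if i = ⟨0, hN⟩ then f i else 0) + (if i = ⟨N - 1, Nat.sub_lt hN one_pos⟩ then f i else 0) := by
    intro i
    have e0 : (i.val = 0) ↔ i = ⟨0, hN⟩ := by rw [Fin.ext_iff]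
    have e1 : (i.val = N - 1) ↔ i = ⟨N - 1, Nat.sub_lt hN one_pos⟩ := by rw [Fin.ext_iff]
    simp only [e0, e1]
    split_ifs <;> ring
  rw [Finset.sum_congr rfl fun i _ => h1 i, Finset.sum_add_distrib, Finset.sum_ite_eq' Finset.univ,
    Finset.sum_ite_eq' Finset.univ]
  simp

/-! ### The energy estimate: smooth weak solutions of `(λ - L†) h = 0` in `L²(μ_T)` vanish -/

section Energy

variable {ω₂ lam β γ : ℝ} (hω : 0 < ω₂) (hl : 0 ≤ lam) (hβ : 0 < β) (hγ : 0 < γ) (hN : 0 < N)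
  {T : ℝ} (hT : 0 < T)
include hω hl hβ hγ hN hT

omit hγ hN hT in
/-- `p_i² ≤ 2 H` for the pinned chain. [folklore] -/
theorem pinnedChain_sq_momentum_le_two_mul_hamiltonian (x : PhaseSpace N) (i : Fin N) :
    x.2 i ^ 2 ≤ 2 * (pinnedChain ω₂ lam β γ).hamiltonian N x := by
  have hsum := pinnedChain_harmonic_le_hamiltonian (ω₂ := ω₂) hl hβ.le γ N x
  have h1 : 0 ≤ ∑ j, ω₂ * x.1 j ^ 2 / 2 := Finset.sum_nonneg fun j _ => by positivity
  have h2 : x.2 i ^ 2 / 2 ≤ ∑ j, x.2 j ^ 2 / 2 :=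
    Finset.single_le_sum (f := fun j => x.2 j ^ 2 / 2) (fun j _ => by positivity) (Finset.mem_univ _)
  linarith

set_option maxHeartbeats 800000 in
-- one long energy computation: cutoff, product rule, AM–GM and two dominated-convergence limits
/-- **The energy estimate** (uniqueness half of essential m-dissipativity). For the pinned chain at
equilibrium temperature `T` and `λ > 0`, ASSUME the Dirichlet-form identity
`∫ F·LF dμ_T = -γT Σ_i ([i=0]+[i=N-1]) ∫ (∂_{p_i}F)² dμ_T` on `C_c^∞`. If `h ∈ C^∞ ∩ L²(μ_T)` satisfies
`∫ (λF - LF) h dμ_T = 0` for all `F ∈ C_c^∞`, then `∫ h² dμ_T = 0`. Proof: with `χ_R = χ(H/R)` and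
`φ = χ_R h ∈ C_c^∞`, testing with `F = χ_R φ` and expanding `L(φ χ_R) = χ_R Lφ + φ Lχ_R + Γ(φ, χ_R)` gives
`λ‖φ‖² = ∫ φLφ + ∫ χ_R h² Lχ_R + 2γT Σ_b ∫ (χ'(H/R) p_b h / R) ∂_{p_b}φ`; the first term is
`-γT Σ_b ‖∂_{p_b}φ‖²`, which absorbs the last by AM–GM, and `Lχ_R`, `(χ'(H/R) p_b/R)²` are bounded and
supported in `{H ≥ R}`, so `λ ∫ χ_R² h² ≤ C ∫_{H ≥ R} h² → 0` as `R → ∞`.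
[cite: CuneoEckmannHairerReyBellet2018, §3.1] -/
theorem integral_sq_eq_zero_of_weak_resolvent {lam' : ℝ} (hlam : 0 < lam')
    (hDir : ∀ F : PhaseSpace N → ℝ, ContDiff ℝ (⊤ : ℕ∞) F → HasCompactSupport F →
      ∫ x, F x * (pinnedChain ω₂ lam β γ).generator N T T F x ∂((pinnedChain ω₂ lam β γ).gibbsMeasure N T) =
        -(γ * T) * ∑ i : Fin N, ((if i.val = 0 then (1 : ℝ) else 0) + (if i.val = N - 1 then (1 : ℝ) else 0)) *
          ∫ x, (partialP i F x) ^ 2 ∂((pinnedChain ω₂ lam β γ).gibbsMeasure N T))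
    {h : PhaseSpace N → ℝ} (hh : ContDiff ℝ (⊤ : ℕ∞) h)
    (hh2 : MemLp h 2 ((pinnedChain ω₂ lam β γ).gibbsMeasure N T))
    (hweak : ∀ F : PhaseSpace N → ℝ, ContDiff ℝ (⊤ : ℕ∞) F → HasCompactSupport F →
      ∫ x, (lam' * F x - (pinnedChain ω₂ lam β γ).generator N T T F x) * h x
        ∂((pinnedChain ω₂ lam β γ).gibbsMeasure N T) = 0) :
    ∫ x, h x ^ 2 ∂((pinnedChain ω₂ lam β γ).gibbsMeasure N T) = 0 := by
  set P := pinnedChain ω₂ lam β γ with hP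
  set μ := P.gibbsMeasure N T with hμ
  haveI : IsProbabilityMeasure μ := pinnedChain_isProbabilityMeasure_gibbsMeasure hω hl hβ.le γ N hT
  have hU : ContDiff ℝ 2 P.U := pinnedChain_contDiff_U ω₂ lam β γ
  have hV : ContDiff ℝ 2 P.V := pinnedChain_contDiff_V ω₂ lam β γ
  have hγ' : P.γ = γ := rfl
  have hγT : 0 ≤ P.γ * T := by rw [hγ']; positivity
  have hN1 : N - 1 < N := Nat.sub_lt hN one_pos
  set b₀ : Fin N := ⟨0, hN⟩ with hb₀
  set b₁ : Fin N := ⟨N - 1, hN1⟩ with hb₁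
  have hHc : Continuous (P.hamiltonian N) := pinnedChain_continuous_hamiltonian ω₂ lam β γ N
  obtain ⟨M₁, hM₁0, hM₁⟩ := SubdiffusiveBondHeat.exists_bound_deriv_smoothCutoff
  obtain ⟨M₂, hM₂0, hM₂⟩ := SubdiffusiveBondHeat.exists_bound_deriv_deriv_smoothCutoff
  have hp2 : ∀ (x : PhaseSpace N) (i : Fin N), x.2 i ^ 2 ≤ 2 * P.hamiltonian N x := fun x i =>
    pinnedChain_sq_momentum_le_two_mul_hamiltonian hω hl hβ (γ := γ) x i
  have hhc : Continuous h := hh.continuous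
  have hI2 : Integrable (fun x => h x ^ 2) μ := hh2.integrable_sq
  have hχs : ∀ R : ℝ, ContDiff ℝ ∞ (fun x : PhaseSpace N => smoothCutoff (P.hamiltonian N x / R)) := fun R =>
    contDiff_energyCutoff (ω₂ := ω₂) (lam := lam) (β := β) γ N R
  have hχ01 : ∀ (R : ℝ) (x : PhaseSpace N), 0 ≤ smoothCutoff (P.hamiltonian N x / R) ∧ smoothCutoff (P.hamiltonian N x / R) ≤ 1 :=
    fun R x => ⟨smoothCutoff_nonneg _, smoothCutoff_le_one _⟩
  have hd1c : ∀ R : ℝ, Continuous fun x : PhaseSpace N => deriv smoothCutoff (P.hamiltonian N x / R) := fun R =>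
    continuous_deriv_smoothCutoff.comp (hHc.div_const R)
  have hd2c : ∀ R : ℝ, Continuous fun x : PhaseSpace N => deriv (deriv smoothCutoff) (P.hamiltonian N x / R) := fun R =>
    continuous_deriv_deriv_smoothCutoff.comp (hHc.div_const R)
  have hsupp : ∀ (R : ℝ), 0 < R → ∀ x : PhaseSpace N, ¬ (R ≤ P.hamiltonian N x ∧ P.hamiltonian N x ≤ 2 * R) →
      deriv smoothCutoff (P.hamiltonian N x / R) = 0 ∧ deriv (deriv smoothCutoff) (P.hamiltonian N x / R) = 0 := by
    intro R hR x hx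
    rcases not_and_or.1 hx with h1 | h1
    · have : P.hamiltonian N x / R < 1 := by rw [div_lt_one hR]; linarith
      exact ⟨deriv_smoothCutoff_of_lt_one this, deriv_deriv_smoothCutoff_of_lt_one this⟩
    · have : 2 < P.hamiltonian N x / R := by rw [lt_div_iff₀ hR]; linarith
      exact ⟨deriv_smoothCutoff_of_two_lt this, deriv_deriv_smoothCutoff_of_two_lt this⟩
  obtain ⟨tail, htail⟩ : ∃ tail : ℝ → ℝ,
      tail = fun R => ∫ x, Set.indicator {x | R ≤ P.hamiltonian N x} (fun x => h x ^ 2) x ∂μ := ⟨_, rfl⟩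
  have hmeasR : ∀ R : ℝ, MeasurableSet {x : PhaseSpace N | R ≤ P.hamiltonian N x} := fun R =>
    measurableSet_le measurable_const hHc.measurable
  have htailI : ∀ R : ℝ, Integrable (Set.indicator {x | R ≤ P.hamiltonian N x} (fun x => h x ^ 2)) μ := fun R =>
    hI2.indicator (hmeasR R)
  have hind_nonneg : ∀ (R : ℝ) (x : PhaseSpace N), 0 ≤ Set.indicator {x | R ≤ P.hamiltonian N x} (fun x => h x ^ 2) x :=
    fun R x => Set.indicator_nonneg (fun y _ => sq_nonneg (h y)) x
  have hind_of_mem : ∀ (R : ℝ) (x : PhaseSpace N), R ≤ P.hamiltonian N x →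
      Set.indicator {x | R ≤ P.hamiltonian N x} (fun x => h x ^ 2) x = h x ^ 2 :=
    fun R x hx => Set.indicator_of_mem (show x ∈ {x | R ≤ P.hamiltonian N x} from hx) _
  set CS : ℝ := γ * (M₁ * (2 * T + 8) + 8 * T * M₂) with hCS
  set Ctot : ℝ := CS + 8 * γ * T * M₁ ^ 2 with hCtot
  have key : ∀ R : ℝ, 1 ≤ R →
      lam' * ∫ x, (h x * smoothCutoff (P.hamiltonian N x / R)) ^ 2 ∂μ ≤ Ctot * tail R := by
    intro R hR
    have hR0 : 0 < R := by linarith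
    obtain ⟨χ, hχ⟩ : ∃ χ : PhaseSpace N → ℝ, χ = fun x => smoothCutoff (P.hamiltonian N x / R) := ⟨_, rfl⟩
    obtain ⟨φ, hφ⟩ : ∃ φ : PhaseSpace N → ℝ, φ = fun x => h x * χ x := ⟨_, rfl⟩
    obtain ⟨F, hF⟩ : ∃ F : PhaseSpace N → ℝ, F = fun x => φ x * smoothCutoff (P.hamiltonian N x / R) := ⟨_, rfl⟩
    have hχcont : Continuous χ := by rw [hχ]; exact (hχs R).continuous
    have hχc : HasCompactSupport χ := by rw [hχ]; exact hasCompactSupport_energyCutoff hω hl hβ.le γ N hR0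
    have hχ01' : ∀ x, 0 ≤ χ x ∧ χ x ≤ 1 := fun x => by rw [hχ]; exact hχ01 R x
    have hφs : ContDiff ℝ ∞ φ := by rw [hφ, hχ]; exact hh.mul (hχs R)
    have hφc : HasCompactSupport φ := by rw [hφ]; exact hχc.mul_left
    have hFs : ContDiff ℝ ∞ F := by rw [hF]; exact hφs.mul (hχs R)
    have hFc : HasCompactSupport F := by
      rw [hF]; exact (hasCompactSupport_energyCutoff hω hl hβ.le γ N hR0).mul_left
    have hφ2 : ContDiff ℝ 2 φ := hφs.of_le (by norm_cast)
    have hφd : Differentiable ℝ φ := hφ2.differentiable (by norm_num)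
    have hφcont : Continuous φ := hφs.continuous
    obtain ⟨Lφ, hLφ⟩ : ∃ Lφ : PhaseSpace N → ℝ, Lφ = P.generator N T T φ := ⟨_, rfl⟩
    have hLφc : Continuous Lφ := by
      rw [hLφ]; exact P.continuous_generator (hU.of_le (by norm_num)) (hV.of_le (by norm_num)) N T T hφ2
    have hLφs : HasCompactSupport Lφ := by rw [hLφ]; exact P.hasCompactSupport_generator N T T hφ2 hφc
    obtain ⟨d₁, hd₁⟩ : ∃ d₁ : PhaseSpace N → ℝ, d₁ = fun x => deriv smoothCutoff (P.hamiltonian N x / R) := ⟨_, rfl⟩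
    obtain ⟨d₂, hd₂⟩ : ∃ d₂ : PhaseSpace N → ℝ, d₂ = fun x => deriv (deriv smoothCutoff) (P.hamiltonian N x / R) := ⟨_, rfl⟩
    have hd₁c : Continuous d₁ := by rw [hd₁]; exact hd1c R
    have hd₂c : Continuous d₂ := by rw [hd₂]; exact hd2c R
    obtain ⟨S, hS⟩ : ∃ S : PhaseSpace N → ℝ, S = fun x => P.γ * (d₁ x / R * (T + T - x.2 b₀ ^ 2 - x.2 b₁ ^ 2) +
      d₂ x / R ^ 2 * (T * x.2 b₀ ^ 2 + T * x.2 b₁ ^ 2)) := ⟨_, rfl⟩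
    obtain ⟨w, hw⟩ : ∃ w : Fin N → PhaseSpace N → ℝ, w = fun i x => d₁ x / R * x.2 i * h x := ⟨_, rfl⟩
    obtain ⟨dφ, hdφ⟩ : ∃ dφ : Fin N → PhaseSpace N → ℝ, dφ = fun i x => partialP i φ x := ⟨_, rfl⟩
    have hχ_apply : ∀ x, χ x = smoothCutoff (P.hamiltonian N x / R) := fun x => by rw [hχ]
    have hφ_apply : ∀ x, φ x = h x * χ x := fun x => by rw [hφ]
    have hF_apply : ∀ x, F x = φ x * smoothCutoff (P.hamiltonian N x / R) := fun x => by rw [hF]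
    have hLφ_apply : ∀ x, Lφ x = P.generator N T T φ x := fun x => by rw [hLφ]
    have hd₁_apply : ∀ x, d₁ x = deriv smoothCutoff (P.hamiltonian N x / R) := fun x => by rw [hd₁]
    have hd₂_apply : ∀ x, d₂ x = deriv (deriv smoothCutoff) (P.hamiltonian N x / R) := fun x => by rw [hd₂]
    have hS_apply : ∀ x, S x = P.γ * (d₁ x / R * (T + T - x.2 b₀ ^ 2 - x.2 b₁ ^ 2) +
        d₂ x / R ^ 2 * (T * x.2 b₀ ^ 2 + T * x.2 b₁ ^ 2)) := fun x => by rw [hS]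
    have hw_apply : ∀ i x, w i x = d₁ x / R * x.2 i * h x := fun i x => by rw [hw]
    have hdφ_apply : ∀ i x, dφ i x = partialP i φ x := fun i x => by rw [hdφ]
    have hM₁' : ∀ x, |d₁ x| ≤ M₁ := fun x => by rw [hd₁_apply]; exact hM₁ _
    have hM₂' : ∀ x, |d₂ x| ≤ M₂ := fun x => by rw [hd₂_apply]; exact hM₂ _
    have hdφc : ∀ i, Continuous (dφ i) := fun i => by rw [hdφ]; exact continuous_partialP hφs (by simp) i
    have hdφs : ∀ i, HasCompactSupport (dφ i) := fun i => by rw [hdφ]; exact hasCompactSupport_partialP hφd hφc i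
    have hq : ∀ i : Fin N, Continuous fun x : PhaseSpace N => x.2 i := fun i =>
      (continuous_apply i).comp continuous_snd
    have hwc : ∀ i, Continuous (w i) := fun i => by
      rw [hw]; exact ((hd₁c.div_const R).mul (hq i)).mul hhc
    have hSc : Continuous S := by
      rw [hS]
      exact continuous_const.mul (((hd₁c.div_const R).mul
        ((continuous_const.sub ((hq b₀).pow 2)).sub ((hq b₁).pow 2))).add
        ((hd₂c.div_const _).mul ((continuous_const.mul ((hq b₀).pow 2)).add
          (continuous_const.mul ((hq b₁).pow 2)))))
    have hprod : ∀ x, P.generator N T T F x * h x =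
        Lφ x * φ x + S x * χ x * h x ^ 2 + 2 * P.γ * T * (w b₀ x * dφ b₀ x + w b₁ x * dφ b₁ x) := by
      intro x
      have e := generator_mul_smoothCutoff_hamiltonian hU hV hN hγT hγT hφ2 R x
      rw [hF, e]
      simp only [hLφ_apply, hS_apply, hw_apply, hdφ_apply, hφ_apply, hχ_apply, hd₁_apply, hd₂_apply, hb₀, hb₁]
      ring
    have hSb : ∀ x, |S x * χ x * h x ^ 2| ≤ CS * Set.indicator {x | R ≤ P.hamiltonian N x} (fun x => h x ^ 2) x := by
      intro x
      by_cases hx : R ≤ P.hamiltonian N x ∧ P.hamiltonian N x ≤ 2 * R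
      · rw [hind_of_mem R x hx.1]
        have hq0 : x.2 b₀ ^ 2 ≤ 4 * R := by nlinarith [hp2 x b₀, hx.2]
        have hq1 : x.2 b₁ ^ 2 ≤ 4 * R := by nlinarith [hp2 x b₁, hx.2]
        have e1 : |d₁ x / R * (T + T - x.2 b₀ ^ 2 - x.2 b₁ ^ 2)| ≤ M₁ * (2 * T + 8) := by
          rw [abs_mul, abs_div, abs_of_pos hR0]
          have ha : |d₁ x| / R ≤ M₁ / R := div_le_div_of_nonneg_right (hM₁' x) hR0.le
          have hb : |T + T - x.2 b₀ ^ 2 - x.2 b₁ ^ 2| ≤ 2 * T + 8 * R := by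
            rw [abs_le]; constructor <;> nlinarith [sq_nonneg (x.2 b₀), sq_nonneg (x.2 b₁)]
          calc |d₁ x| / R * |T + T - x.2 b₀ ^ 2 - x.2 b₁ ^ 2| ≤ M₁ / R * (2 * T + 8 * R) :=
                mul_le_mul ha hb (abs_nonneg _) (by positivity)
            _ = M₁ * (2 * T / R + 8) := by field_simp
            _ ≤ M₁ * (2 * T + 8) := by
                gcongr
                exact div_le_self (by positivity) hR
        have e2 : |d₂ x / R ^ 2 * (T * x.2 b₀ ^ 2 + T * x.2 b₁ ^ 2)| ≤ 8 * T * M₂ := by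
          rw [abs_mul, abs_div, abs_of_pos (by positivity : (0 : ℝ) < R ^ 2)]
          have ha : |d₂ x| / R ^ 2 ≤ M₂ / R ^ 2 := div_le_div_of_nonneg_right (hM₂' x) (by positivity)
          have hb : |T * x.2 b₀ ^ 2 + T * x.2 b₁ ^ 2| ≤ 8 * T * R := by
            rw [abs_of_nonneg (by positivity)]; nlinarith
          calc |d₂ x| / R ^ 2 * |T * x.2 b₀ ^ 2 + T * x.2 b₁ ^ 2| ≤ M₂ / R ^ 2 * (8 * T * R) :=
                mul_le_mul ha hb (abs_nonneg _) (by positivity)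
            _ = 8 * T * M₂ / R := by field_simp
            _ ≤ 8 * T * M₂ := div_le_self (by positivity) hR
        have hSx : |S x| ≤ CS := by
          have := abs_add_le (d₁ x / R * (T + T - x.2 b₀ ^ 2 - x.2 b₁ ^ 2))
            (d₂ x / R ^ 2 * (T * x.2 b₀ ^ 2 + T * x.2 b₁ ^ 2))
          rw [hS_apply, abs_mul, hγ', abs_of_pos hγ, hCS]
          exact mul_le_mul_of_nonneg_left (this.trans (add_le_add e1 e2)) hγ.le
        have hCS0 : 0 ≤ CS := by rw [hCS]; positivity
        rw [abs_mul, abs_mul, abs_of_nonneg (hχ01' x).1, abs_of_nonneg (sq_nonneg (h x))]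
        calc |S x| * χ x * h x ^ 2 ≤ CS * 1 * h x ^ 2 :=
              mul_le_mul (mul_le_mul hSx (hχ01' x).2 (hχ01' x).1 hCS0) le_rfl (sq_nonneg _) (by positivity)
          _ = CS * h x ^ 2 := by ring
      · obtain ⟨h1, h2⟩ := hsupp R hR0 x hx
        have : S x = 0 := by rw [hS_apply, hd₁_apply, hd₂_apply, h1, h2]; ring
        rw [this, zero_mul, zero_mul, abs_zero]
        exact mul_nonneg (by positivity) (hind_nonneg R x)
    have hwb : ∀ (i : Fin N) (x : PhaseSpace N),
        (w i x) ^ 2 ≤ 4 * M₁ ^ 2 * Set.indicator {x | R ≤ P.hamiltonian N x} (fun x => h x ^ 2) x := by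
      intro i x
      by_cases hx : R ≤ P.hamiltonian N x ∧ P.hamiltonian N x ≤ 2 * R
      · rw [hind_of_mem R x hx.1]
        have hq : x.2 i ^ 2 ≤ 4 * R := by nlinarith [hp2 x i, hx.2]
        have hdd : (d₁ x) ^ 2 ≤ M₁ ^ 2 := by
          rw [← sq_abs]; exact pow_le_pow_left₀ (abs_nonneg _) (hM₁' x) 2
        have e : (w i x) ^ 2 = (d₁ x) ^ 2 * x.2 i ^ 2 * h x ^ 2 / R ^ 2 := by
          rw [hw_apply]; ring
        rw [e, div_le_iff₀ (by positivity)]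
        have h3 : (d₁ x) ^ 2 * x.2 i ^ 2 ≤ M₁ ^ 2 * (4 * R) :=
          mul_le_mul hdd hq (sq_nonneg _) (sq_nonneg _)
        have h4a : (d₁ x) ^ 2 * x.2 i ^ 2 * h x ^ 2 ≤ M₁ ^ 2 * (4 * R) * h x ^ 2 :=
          mul_le_mul_of_nonneg_right h3 (sq_nonneg _)
        have hRR : R ≤ R ^ 2 := by nlinarith
        have h4b : M₁ ^ 2 * (4 * R) * h x ^ 2 ≤ 4 * M₁ ^ 2 * h x ^ 2 * R ^ 2 := by
          have h0 : 0 ≤ M₁ ^ 2 * h x ^ 2 := by positivity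
          nlinarith
        linarith
      · obtain ⟨h1, -⟩ := hsupp R hR0 x hx
        have : w i x = 0 := by rw [hw_apply, hd₁_apply, h1]; ring
        rw [this]
        simpa using mul_nonneg (by positivity : (0 : ℝ) ≤ 4 * M₁ ^ 2) (hind_nonneg R x)
    have i1 : Integrable (fun x => φ x * Lφ x) μ :=
      (hφcont.mul hLφc).integrable_of_hasCompactSupport hLφs.mul_left
    have i2 : Integrable (fun x => S x * χ x * h x ^ 2) μ := by
      refine Integrable.mono' ((htailI R).const_mul CS)
        ((hSc.mul hχcont).mul (hhc.pow 2)).aestronglyMeasurable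
        (Eventually.of_forall fun x => ?_)
      rw [Real.norm_eq_abs]
      exact hSb x
    have i3 : ∀ i, Integrable (fun x => w i x * dφ i x) μ := fun i =>
      ((hwc i).mul (hdφc i)).integrable_of_hasCompactSupport (hdφs i).mul_left
    have i4 : ∀ i, Integrable (fun x => (w i x) ^ 2) μ := fun i => by
      refine Integrable.mono' ((htailI R).const_mul (4 * M₁ ^ 2)) ((hwc i).pow 2).aestronglyMeasurable
        (Eventually.of_forall fun x => ?_)
      rw [Real.norm_eq_abs, abs_of_nonneg (sq_nonneg _)]
      exact hwb i x
    have i5 : ∀ i, Integrable (fun x => (dφ i x) ^ 2) μ := fun i =>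
      ((hdφc i).memLp_of_hasCompactSupport (hdφs i)).integrable_sq
    have iFh : Integrable (fun x => F x * h x) μ := by
      have e : (fun x => F x * h x) = fun x => φ x ^ 2 := by
        funext x; rw [hF_apply, hφ_apply, hχ_apply]; ring
      rw [e]
      exact (hφcont.memLp_of_hasCompactSupport hφc).integrable_sq
    have hF2 : ContDiff ℝ 2 F := hFs.of_le (by norm_cast)
    have hLFc : Continuous (P.generator N T T F) :=
      P.continuous_generator (hU.of_le (by norm_num)) (hV.of_le (by norm_num)) N T T hF2
    have iLFh : Integrable (fun x => P.generator N T T F x * h x) μ :=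
      (hLFc.mul hhc).integrable_of_hasCompactSupport (P.hasCompactSupport_generator N T T hF2 hFc).mul_right
    have hw0 := hweak F hFs hFc
    have hsplit : ∫ x, (lam' * F x - P.generator N T T F x) * h x ∂μ =
        lam' * ∫ x, φ x ^ 2 ∂μ - ∫ x, P.generator N T T F x * h x ∂μ := by
      have e : (fun x => (lam' * F x - P.generator N T T F x) * h x) =
          fun x => lam' * (F x * h x) - P.generator N T T F x * h x := by
        funext x; ring
      rw [e, integral_sub (iFh.const_mul lam') iLFh, integral_const_mul]
      congr 2
      refine integral_congr_ae (Eventually.of_forall fun x => ?_)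
      show F x * h x = φ x ^ 2
      rw [hF_apply, hφ_apply, hχ_apply]; ring
    have hLFh : ∫ x, P.generator N T T F x * h x ∂μ =
        (∫ x, φ x * Lφ x ∂μ) + (∫ x, S x * χ x * h x ^ 2 ∂μ) +
          2 * P.γ * T * ((∫ x, w b₀ x * dφ b₀ x ∂μ) + ∫ x, w b₁ x * dφ b₁ x ∂μ) := by
      have e : (fun x => P.generator N T T F x * h x) = fun x =>
          (φ x * Lφ x + S x * χ x * h x ^ 2) +
            2 * P.γ * T * (w b₀ x * dφ b₀ x + w b₁ x * dφ b₁ x) := by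
        funext x; rw [hprod x]; ring
      have i12 : Integrable (fun x => φ x * Lφ x + S x * χ x * h x ^ 2) μ := i1.add i2
      have i3s : Integrable (fun x => w b₀ x * dφ b₀ x + w b₁ x * dφ b₁ x) μ := (i3 b₀).add (i3 b₁)
      have i33 : Integrable (fun x => 2 * P.γ * T * (w b₀ x * dφ b₀ x + w b₁ x * dφ b₁ x)) μ := i3s.const_mul _
      rw [e, integral_add i12 i33, integral_add i1 i2, integral_const_mul, integral_add (i3 b₀) (i3 b₁)]
    have hDφ : ∫ x, φ x * Lφ x ∂μ =
        -(γ * T) * ((∫ x, (dφ b₀ x) ^ 2 ∂μ) + ∫ x, (dφ b₁ x) ^ 2 ∂μ) := by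
      have h1 := hDir φ hφs hφc
      rw [sum_contactWeight_mul hN] at h1
      have e1 : ∫ x, φ x * Lφ x ∂μ = ∫ x, φ x * P.generator N T T φ x ∂μ := by simp_rw [hLφ_apply]
      have e2 : ∀ i, ∫ x, (dφ i x) ^ 2 ∂μ = ∫ x, (partialP i φ x) ^ 2 ∂μ := fun i => by simp_rw [hdφ_apply]
      rw [e1, e2, e2, hb₀, hb₁]
      exact h1
    have hAMGM : ∀ i, 2 * ∫ x, w i x * dφ i x ∂μ ≤ (∫ x, (w i x) ^ 2 ∂μ) + ∫ x, (dφ i x) ^ 2 ∂μ := by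
      intro i
      rw [← integral_const_mul, ← integral_add (i4 i) (i5 i)]
      refine integral_mono ((i3 i).const_mul 2) ((i4 i).add (i5 i)) fun x => ?_
      show 2 * (w i x * dφ i x) ≤ w i x ^ 2 + dφ i x ^ 2
      nlinarith [sq_nonneg (w i x - dφ i x)]
    have hwI : ∀ i, ∫ x, (w i x) ^ 2 ∂μ ≤ 4 * M₁ ^ 2 * tail R := by
      intro i
      rw [htail]
      simp only
      rw [← integral_const_mul]
      exact integral_mono (i4 i) ((htailI R).const_mul _) fun x => hwb i x
    have hSI : ∫ x, S x * χ x * h x ^ 2 ∂μ ≤ CS * tail R := by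
      rw [htail]
      simp only
      rw [← integral_const_mul]
      exact integral_mono i2 ((htailI R).const_mul _) fun x => (le_abs_self _).trans (hSb x)
    have hφ2eq : ∫ x, (h x * smoothCutoff (P.hamiltonian N x / R)) ^ 2 ∂μ = ∫ x, φ x ^ 2 ∂μ := by rw [hφ, hχ]
    rw [hφ2eq]
    have hmain : lam' * ∫ x, φ x ^ 2 ∂μ = ∫ x, P.generator N T T F x * h x ∂μ := by
      rw [hsplit] at hw0; linarith
    rw [hmain, hLFh, hDφ, hγ']
    have hγT' : 0 ≤ γ * T := by positivity
    have hA0 : 0 ≤ ∫ x, (dφ b₀ x) ^ 2 ∂μ := integral_nonneg fun x => sq_nonneg _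
    have hA1 : 0 ≤ ∫ x, (dφ b₁ x) ^ 2 ∂μ := integral_nonneg fun x => sq_nonneg _
    have htail0 : 0 ≤ tail R := by rw [htail]; exact integral_nonneg fun x => hind_nonneg R x
    have c0 := mul_le_mul_of_nonneg_left (hAMGM b₀) hγT'
    have c1 := mul_le_mul_of_nonneg_left (hAMGM b₁) hγT'
    have d0 := mul_le_mul_of_nonneg_left (hwI b₀) hγT'
    have d1 := mul_le_mul_of_nonneg_left (hwI b₁) hγT'
    rw [hCtot]
    nlinarith [hSI, c0, c1, d0, d1, hA0, hA1, htail0]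
  have hlim1 : Tendsto (fun R : ℝ => ∫ x, (h x * smoothCutoff (P.hamiltonian N x / R)) ^ 2 ∂μ) atTop
      (𝓝 (∫ x, h x ^ 2 ∂μ)) := by
    refine tendsto_integral_filter_of_dominated_convergence (fun x => h x ^ 2)
      (Eventually.of_forall fun R => ((hhc.mul (hχs R).continuous).pow 2).aestronglyMeasurable)
      (Eventually.of_forall fun R => ae_of_all _ fun x => ?_) hI2 (ae_of_all _ fun x => ?_)
    · rw [Real.norm_eq_abs, abs_of_nonneg (sq_nonneg _), mul_pow]
      have h1 : smoothCutoff (P.hamiltonian N x / R) ^ 2 ≤ 1 := by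
        have := hχ01 R x
        nlinarith
      nlinarith [sq_nonneg (h x)]
    · have ht := (tendsto_const_nhds (x := h x)).mul (tendsto_energyCutoff_atTop P N x)
      rw [mul_one] at ht
      exact ht.pow 2
  have hlim2 : Tendsto tail atTop (𝓝 0) := by
    have h0 : (0 : ℝ) = ∫ _ : PhaseSpace N, (0 : ℝ) ∂μ := by simp
    rw [h0, htail]
    refine tendsto_integral_filter_of_dominated_convergence (fun x => h x ^ 2)
      (Eventually.of_forall fun R => (htailI R).aestronglyMeasurable)
      (Eventually.of_forall fun R => ae_of_all _ fun x => ?_) hI2 (ae_of_all _ fun x => ?_)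
    · rw [Real.norm_eq_abs, abs_of_nonneg (hind_nonneg R x)]
      by_cases hx : R ≤ P.hamiltonian N x
      · rw [hind_of_mem R x hx]
      · rw [Set.indicator_of_notMem (show x ∉ {x | R ≤ P.hamiltonian N x} from hx)]
        exact sq_nonneg _
    · refine tendsto_const_nhds.congr' ?_
      filter_upwards [eventually_gt_atTop (P.hamiltonian N x)] with R hR
      rw [Set.indicator_of_notMem]
      exact fun hx => (not_le.2 hR) hx
  have hle : lam' * ∫ x, h x ^ 2 ∂μ ≤ Ctot * 0 :=
    le_of_tendsto_of_tendsto (hlim1.const_mul lam') (hlim2.const_mul Ctot) (by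
      filter_upwards [eventually_ge_atTop (1 : ℝ)] with R hR
      exact key R hR)
  have h0 : 0 ≤ ∫ x, h x ^ 2 ∂μ := integral_nonneg fun x => sq_nonneg _
  rw [mul_zero] at hle; nlinarith

end Energy

/-- **Registered sub-goal `pinnedChain_energyUniqueness`** of crux stmt-AtomisticToContinuum-9121 (under
`stub_clausiusBudget`): `integral_sq_eq_zero_of_weak_resolvent` in closed form.
[cite: CuneoEckmannHairerReyBellet2018, §3.1] -/
theorem pinnedChain_energyUniqueness : ∀ ω₂ lam β γ : ℝ, 0 < ω₂ → 0 ≤ lam → 0 < β → 0 < γ → ∀ (N : ℕ), 0 < N → ∀ T : ℝ, 0 < T → ∀ lam' : ℝ, 0 < lam' → (∀ F : PhaseSpace N → ℝ, ContDiff ℝ (⊤ : ℕ∞) F → HasCompactSupport F → ∫ x, F x * (pinnedChain ω₂ lam β γ).generator N T T F x ∂((pinnedChain ω₂ lam β γ).gibbsMeasure N T) = -(γ * T) * ∑ i : Fin N, ((if i.val = 0 then (1 : ℝ) else 0) + (if i.val = N - 1 then (1 : ℝ) else 0)) * ∫ x, (partialP i F x) ^ 2 ∂((pinnedChain ω₂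 lam β γ).gibbsMeasure N T)) → ∀ h : PhaseSpace N → ℝ, ContDiff ℝ (⊤ : ℕ∞) h → MemLp h 2 ((pinnedChain ω₂ lam β γ).gibbsMeasure N T) → (∀ F : PhaseSpace N → ℝ, ContDiff ℝ (⊤ : ℕ∞) F → HasCompactSupport F → ∫ x, (lam' * F x - (pinnedChain ω₂ lam β γ).generator N T T F x) * h x ∂((pinnedChain ω₂ lam β γ).gibbsMeasure N T) = 0) → ∫ x, h x ^ 2 ∂((pinnedChain ω₂ lam β γ).gibbsMeasure N T) = 0 :=
  fun _ _ _ _ hω hl hβ hγ _ hN _ hT _ hlam hDir _ hh hh2 hweak =>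
    integral_sq_eq_zero_of_weak_resolvent hω hl hβ hγ hN hT hlam hDir hh hh2 hweak

end Summit.AtomisticToContinuum.FouriersLaw.Theorems.ExtensiveSnapshotIrreversibility.ClausiusBudget

end
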